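import Summits.AtomisticToContinuum.BoseEinsteinCondensation.Theorems.PuffFloor.Negative.FreeGasModel
import Literature.MathematicalPhysics.QuantumManyBody.HardCoreScatteringLength
import HarnessLib

/-!
# Pointwise-positive finite-energy states do not exist for hard cores (vacuity of class-blind `Ψ ≠ 0` statements; crux `HardCoreExtension`, stmt-AtomisticToContinuum-11786)

Standing adversary of crux `HardCoreExtension` (route `BECConjugateDomination`), gen 3. The crux asks to
carry statements proved on the SMOOTH class over to hard cores; the route's mechanism items
(`InfraredMinimumUncertainty`, `PuffFloor`) and several crux-ideate levers quantify over periodic trial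
states that are minimisers / near-minimisers with FINITE energy AND POINTWISE NON-ZERO
(`∀ X, Ψ.ψ X ≠ 0`, needed for `log g` and for the `n₀ = (N/V)∫g` identity of `IMUChainGlue`). This
file records, sorry-free, that for a HARD CORE the two hypotheses are jointly unsatisfiable, so any
class-blind extension of such a statement that keeps `Ψ ≠ 0` is VACUOUSLY TRUE at hard cores and
carries no information there:

* `periodicEnergy_hardCore_eq_top_of_ne_zero` — for `v = hardCorePotential a` (`a > 0`), `N ≥ 2`,
  `L > 0`: a periodic trial state that does not vanish at the coincidence configuration
  `X₀ = (c, …, c)`, `c` the centre of the cell, has `periodicEnergy v Ψ = ⊤` (by continuity `Ψ ≠ 0`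
  on an open neighbourhood of `X₀` inside the open box, where two particles are closer than `a`, so
  the integrand `v^per·|Ψ|²` is `⊤` on a set of positive measure);
* `exists_eq_zero_of_periodicEnergy_hardCore_ne_top` — hence every finite-energy state of the
  hard-core gas has a zero; `not_finiteEnergy_and_pos_hardCore` — the conjunction
  "finite energy ∧ pointwise non-zero" is FALSE for every state;
* `puffFloorShape_vacuous_at_hardCore` — illustration: the body of the route's `PuffFloor`, read
  verbatim at `v = hardCorePotential a` (any `C`, any density, any `n ≥ 1`), holds trivially.

Moral for the class-blind lines (`second-moment-floor-class-blind` ≈ `third-law-current-floor`): at hard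
cores, drop `Ψ ≠ 0` (allow zeros; `log g` is still fine since the ONE-BODY coherence `g` stays
positive) and replace exact minimisers (none exist in the `C¹` class — unique continuation, see
`Cruxes/HardCoreExtension/Disproof.lean` §10) by gap-scale near-minimisers with capped floors.
No Theses statement is asserted positively. All `[folklore]`.
-/

noncomputable section

namespace Summit.AtomisticToContinuum.BoseEinsteinCondensation.Theorems.HardCoreExtension.Negative

open Literature.MathematicalPhysics.QuantumManyBody.BoseGas MeasureTheory Filter Metric
open Summit.AtomisticToContinuum.BoseEinsteinCondensation.Theorems.PuffFloor.Negative
  (openBoxN isOpen_openBoxN openBoxN_subset_cellN)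
open scoped ENNReal NNReal

variable {N : ℕ} {L a : ℝ}

/-- The coincidence configuration at the centre of the cell (every particle at `(L/2, L/2, L/2)`)
lies in the open box. [folklore] -/
theorem centreConfig_mem_openBoxN (hL : 0 < L) :
    (fun _ => (WithLp.toLp 2 (fun _ : Fin 3 => L / 2) : Space) : Config N) ∈ openBoxN N L :=
  fun i a => by
    simp only [Set.mem_Ioo]
    constructor <;> linarith

/-- The pair term `v(|xᵢ − xⱼ|)`, `i < j`, is a lower bound for the interaction. [folklore] -/
theorem le_interaction (v : ℝ → ℝ≥0∞) {i j : Fin N} (hij : i < j) (X : Config N) :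
    v (dist (X i) (X j)) ≤ interaction v X := by
  unfold interaction
  refine le_trans ?_ (Finset.single_le_sum
    (f := fun i' : Fin N => ∑ j' ∈ Finset.univ.filter (fun j' => i' < j'), v (dist (X i') (X j')))
    (fun _ _ => bot_le) (Finset.mem_univ i))
  exact Finset.single_le_sum (f := fun j' : Fin N => v (dist (X i) (X j')))
    (fun _ _ => bot_le) (Finset.mem_filter.2 ⟨Finset.mem_univ j, hij⟩)

/-- Within distance `a` of each other, two hard spheres make the periodic interaction infinite.
[folklore] -/
theorem periodicInteraction_hardCore_eq_top {i j : Fin N} (hij : i < j) {X : Config N}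
    (hX : dist (X i) (X j) < a) (L : ℝ) :
    periodicInteraction (hardCorePotential a) L X = ⊤ := by
  refine eq_top_iff.2 ?_
  calc (⊤ : ℝ≥0∞) = hardCorePotential a (dist (X i) (X j)) := (hardCorePotential_of_lt hX).symm
    _ ≤ interaction (hardCorePotential a) X := le_interaction _ hij X
    _ ≤ periodicInteraction (hardCorePotential a) L X := interaction_le_periodicInteraction _ L X

/-- **A state of the hard-core gas that does not vanish at the coincidence configuration has infinite
energy** (`a > 0`, `N ≥ 2`, `L > 0`). [folklore] -/
theorem periodicEnergy_hardCore_eq_top_of_ne_zero (ha : 0 < a) (hN : 2 ≤ N) (hL : 0 < L)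
    (Ψ : PeriodicTrialState N L)
    (hΨ : Ψ.ψ (fun _ => (WithLp.toLp 2 (fun _ : Fin 3 => L / 2) : Space)) ≠ 0) :
    periodicEnergy (hardCorePotential a) Ψ = ⊤ := by
  set X₀ : Config N := fun _ => (WithLp.toLp 2 (fun _ : Fin 3 => L / 2) : Space) with hX₀
  set i₀ : Fin N := ⟨0, by omega⟩ with hi₀
  set i₁ : Fin N := ⟨1, by omega⟩ with hi₁
  have h01 : i₀ < i₁ := by rw [hi₀, hi₁, Fin.lt_def]; exact Nat.zero_lt_one
  -- the open set where the integrand is `⊤`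
  set U : Set (Config N) :=
    {X | dist (X i₀) (X i₁) < a} ∩ ({X | Ψ.ψ X ≠ 0} ∩ openBoxN N L) with hU
  have hcont : Continuous Ψ.ψ := Ψ.contDiff.continuous
  have hUo : IsOpen U := by
    refine IsOpen.inter ?_ ((isOpen_ne_fun hcont continuous_const).inter (isOpen_openBoxN N L))
    exact isOpen_lt (by fun_prop) continuous_const
  have hX₀U : X₀ ∈ U := by
    refine ⟨?_, hΨ, centreConfig_mem_openBoxN hL⟩
    show dist (X₀ i₀) (X₀ i₁) < a
    rw [show X₀ i₀ = X₀ i₁ from rfl, dist_self]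
    exact ha
  have hUpos : volume U ≠ 0 := (hUo.measure_pos volume ⟨_, hX₀U⟩).ne'
  have hUcell : U ⊆ cellN N L := fun X hX => openBoxN_subset_cellN N L hX.2.2
  -- on `U` the integrand is `⊤`
  have htop : ∀ X ∈ U, (⊤ : ℝ≥0∞) ≤
      kineticDensity Ψ.ψ X + periodicInteraction (hardCorePotential a) L X * ((‖Ψ.ψ X‖₊ : ℝ≥0∞)) ^ 2 := by
    intro X hX
    have h1 : periodicInteraction (hardCorePotential a) L X = ⊤ :=
      periodicInteraction_hardCore_eq_top h01 hX.1 L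
    have h2 : ((‖Ψ.ψ X‖₊ : ℝ≥0∞)) ^ 2 ≠ 0 := by
      have : (‖Ψ.ψ X‖₊ : ℝ≥0∞) ≠ 0 := by
        rw [Ne, ENNReal.coe_eq_zero, nnnorm_eq_zero]; exact hX.2.1
      exact pow_ne_zero 2 this
    rw [h1, ENNReal.top_mul h2]
    exact le_add_self
  -- integrate
  refine eq_top_iff.2 ?_
  calc (⊤ : ℝ≥0∞) = ⊤ * volume U := (ENNReal.top_mul hUpos).symm
    _ = ∫⁻ _ in U, (⊤ : ℝ≥0∞) := (setLIntegral_const U ⊤).symm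
    _ ≤ ∫⁻ X in U, kineticDensity Ψ.ψ X +
          periodicInteraction (hardCorePotential a) L X * ((‖Ψ.ψ X‖₊ : ℝ≥0∞)) ^ 2 :=
        setLIntegral_mono' hUo.measurableSet htop
    _ ≤ periodicEnergy (hardCorePotential a) Ψ := lintegral_mono_set hUcell

/-- **Every finite-energy state of the hard-core gas has a zero** (at the coincidence configuration).
[folklore] -/
theorem exists_eq_zero_of_periodicEnergy_hardCore_ne_top (ha : 0 < a) (hN : 2 ≤ N) (hL : 0 < L)
    (Ψ : PeriodicTrialState N L) (hE : periodicEnergy (hardCorePotential a) Ψ ≠ ⊤) :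
    ∃ X, Ψ.ψ X = 0 := by
  by_contra h
  exact hE (periodicEnergy_hardCore_eq_top_of_ne_zero ha hN hL Ψ fun h0 => h ⟨_, h0⟩)

/-- **"Finite energy and pointwise non-zero" is unsatisfiable for hard cores.** Any class-blind
statement quantifying over such states (the shape of the route's `InfraredMinimumUncertainty` /
`PuffFloor` read at `v = hardCorePotential a`) is vacuous there. [folklore] -/
theorem not_finiteEnergy_and_pos_hardCore (ha : 0 < a) (hN : 2 ≤ N) (hL : 0 < L)
    (Ψ : PeriodicTrialState N L) :
    ¬ (periodicEnergy (hardCorePotential a) Ψ ≠ ⊤ ∧ ∀ X, Ψ.ψ X ≠ 0) := fun h =>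
  h.1 (periodicEnergy_hardCore_eq_top_of_ne_zero ha hN hL Ψ (h.2 _))

/-- **Illustration: the `PuffFloor` body read verbatim at a hard core holds trivially** — for every
`a > 0`, every `C`, every density `ρ > 0`, every `n ≥ 1` and every state, because the hypotheses
"finite energy" and "pointwise non-zero" cannot both hold (minimality, reality and the mode are never
inspected). So extending `PuffFloor`/`IMU` to hard cores by merely widening the class of `v` proves
nothing about hard cores. [folklore] -/
theorem puffFloorShape_vacuous_at_hardCore (ha : 0 < a) (C : ℝ) {ρ : ℝ} (hρ : 0 < ρ) {n : ℕ}
    (hn : 1 ≤ n) (Ψ : PeriodicTrialState (n + 1) (sideLength ρ (n + 1))) :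
    (let L : ℝ := sideLength ρ (n + 1)
     let S : (Fin 3 → ℤ) → ℝ := fun m => ((n : ℝ) + 1)⁻¹ *
       ∫ X in cellN (n + 1) L, ‖∑ j : Fin (n + 1), cellWave L m (X j)‖ ^ 2 * ‖Ψ.ψ X‖ ^ 2
     let kn : (Fin 3 → ℤ) → ℝ := fun m => ‖((2 * Real.pi / L) • latticeVec 1 m)‖
     periodicEnergy (hardCorePotential a) Ψ =
         periodicGroundStateEnergy (hardCorePotential a) (n + 1) L →
       periodicEnergy (hardCorePotential a) Ψ ≠ ⊤ →
       (∀ X, Ψ.ψ X = (‖Ψ.ψ X‖ : ℂ)) → (∀ X, Ψ.ψ X ≠ 0) →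
       ∀ m : Fin 3 → ℤ, m ≠ 0 → kn m / Real.sqrt (kn m ^ 2 + C * ρ) ≤ S m) := by
  dsimp only
  intro _ hfin _ hpos
  have hL : 0 < sideLength ρ (n + 1) := Real.rpow_pos_of_pos (by positivity) _
  exact absurd ⟨hfin, hpos⟩ (not_finiteEnergy_and_pos_hardCore ha (by omega) hL Ψ)

end Summit.AtomisticToContinuum.BoseEinsteinCondensation.Theorems.HardCoreExtension.Negative

end
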